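import Summits.BirchSwinnertonDyer.Rank1Residual.X12.O11.RouteUBernoulliD11
import Mathlib.NumberTheory.LegendreSymbol.JacobiSymbol
import HarnessLib

/-!
# ROUTE U, composite members: a `Fact`-free Euler-criterion form of the Jacobi symbol at a prime,
# so that Bernoulli–Hurwitz certificate sums with values `J(j|q₁)J(j|q₂)J(j|r)` evaluate by `decide +kernel`

bsd-cm cell (run/shared/lean/pub/bsd-cm/), ROUTE U, seat `bsd-cm-ram` (g5). The member certificates of
`RouteUBiprimeMember.bsdp_seven_of_twist_cm7_biprime` are mod-`49` sums of `J(j|q₁q₂)·J(j|r)·j^e`.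
`RouteUBernoulliD11.legendreSym_eq_ite` turns a Legendre symbol into a decidable `if`, but its statement
needs a `Fact p.Prime` INSTANCE; a member file that declares such an instance for a prime already carrying
one elsewhere in the tree (e.g. `5`, `17`) is a duplicate declaration, and a local `haveI` instance is a
free variable that `decide` refuses. This file states the same Euler-criterion `if` for `jacobiSym a p`
with the primality of `p` as a HYPOTHESIS (no instance in the statement): `jacobiSym_prime_eq_ite`.
THEOREMS ONLY; nothing booked. [cite: Cox2013, §1.C Lemma 1.14] [cite: Washington1997, §5.1]
-/

namespace Summit.BirchSwinnertonDyer.Rank1Residual.X12.O11.RouteU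

/-- **Euler's criterion for the Jacobi symbol at an odd prime, `Fact`-free form**: for `p` an odd prime,
`J(a | p) = 0` if `p ∣ a`, else `1` or `−1` according as `a^{(p−1)/2} ≡ 1 (mod p)` or not — the
statement carries `p.Prime` as a hypothesis, so instances of it at numerals contain no free variables and
`decide +kernel` evaluates them. [cite: Cox2013, §1.C Lemma 1.14] -/
theorem jacobiSym_prime_eq_ite (p : ℕ) (hp : p.Prime) (hp2 : p ≠ 2) (a : ℤ) :
    jacobiSym a p = if (a : ZMod p) = 0 then 0 else if (a : ZMod p) ^ (p / 2) = 1 then 1 else -1 := by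
  haveI := Fact.mk hp
  rw [← jacobiSym.legendreSym.to_jacobiSym, legendreSym_eq_ite p hp2]

/-- `J(a | q₁q₂) = J(a | q₁)·J(a | q₂)` for nonzero `q₁, q₂` (multiplicativity in the lower entry).
[cite: Cox2013, §1.C Lemma 1.14] -/
theorem jacobiSym_mul_right' (a : ℤ) {q₁ q₂ : ℕ} (h₁ : q₁ ≠ 0) (h₂ : q₂ ≠ 0) :
    jacobiSym a (q₁ * q₂) = jacobiSym a q₁ * jacobiSym a q₂ :=
  haveI : NeZero q₁ := ⟨h₁⟩
  haveI : NeZero q₂ := ⟨h₂⟩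
  jacobiSym.mul_right a q₁ q₂

end Summit.BirchSwinnertonDyer.Rank1Residual.X12.O11.RouteU
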